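import Mathlib.Algebra.BigOperators.Group.Finset.Basic
import Mathlib.Algebra.Order.BigOperators.Group.Finset
import Mathlib.Data.Finset.Powerset
import Literature.Computability.Complexity.SymPlus
import HarnessLib

/-!
# Yates' algorithm for the zeta transform and the evaluation of `SYM⁺` circuits

Literature / circuit complexity, the mathematics of Williams' *evaluation lemma*
(R. Williams, *Nonuniform ACC circuit lower bounds*, J. ACM 61 (2014), Lemma 4.2, Proof 2
"Dynamic Programming"; the machine-level statement is the named fact
`Williams2014_lemma_4_2` of `Williams2014AccSat.lean`). Everything here is proved:

* `zetaTransform f T = ∑_{S ⊆ T} f S` — the zeta transform of `f : Finset (Fin n) → ℕ`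
  (Williams: "`g(T) = Σ_{S ⊆ T} f(S)` … typically, `g` is called the zeta transform of `f`");
* `SymPlus.count_eq_zetaTransform`, `SymPlus.eval_eq_sym_zetaTransform` — for a `SYM⁺` circuit
  with term multiplicities `f(S) = #{j : G_j = S}`, the number of AND-terms true at the point
  `1_T` is `g(T)` ("`g(T)` equals the number of AND gates set to `1` on the variable assignment
  obtained by setting `xᵢ = 1` for `i ∈ T`, and `xᵢ = 0` for `i ∉ T`"), so the circuit's value
  there is `sym (g T)`, and `SymPlus.exists_eval_iff`: the circuit is satisfiable iff some entry
  of the table `g` is accepted by the symmetric gate (the final scan of the SAT algorithm);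
* `yatesIter f k` — Yates' dynamic programme (1937; Williams, loc. cit., after
  Björklund–Husfeldt–Koivisto 2009, §2.2): `g₀ = f`,
  `gᵢ(T) = gᵢ₋₁(T) + [i ∈ T] · gᵢ₋₁(T ∖ {i})` (`yatesStep`), and its invariant
  `yatesIter_eq_partial`: after the coordinates `< k` are processed, `g_k(T) = Σ f(S)` over the
  `S ⊆ T` that agree with `T` on the coordinates `≥ k` ("induction shows that `gᵢ(T) = Σ f(S)`
  where the sum is over all `S ⊆ T` subject to the condition `{j ∈ S | j > i} = {j ∈ T | j > i}`"),
  whence `yatesIter_n : yatesIter f n = zetaTransform f` ("when `i = n` … `g_n = g`").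
  Each of the `n` stages reads every table entry once: `n · 2ⁿ` additions of numbers `≤ #terms`
  (`zetaTransform_count_le`), which is the `O(2ⁿ · poly(n))` operation count of the lemma.

Coordinates are `Fin n` and processed in the order `0, 1, …, n - 1` (Williams indexes
`1, …, n`). Mathlib has Möbius inversion for incidence algebras but not this algorithm.

## References

* R. Williams, *Nonuniform ACC circuit lower bounds*, J. ACM 61(1) (2014), Lemma 4.2, Proof 2
  [Williams2014].
* F. Yates, *The design and analysis of factorial experiments*, Imperial Bureau of Soil Science,
  Harpenden 1937; A. Björklund, T. Husfeldt, M. Koivisto, *Set partitioning via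
  inclusion–exclusion*, SIAM J. Comput. 39 (2009), §2.2 (as cited by Williams).
-/

namespace Literature.Computability.Complexity

open Finset

variable {n : ℕ}

/-! ### The zeta transform -/

/-- The *zeta transform* of `f : Finset (Fin n) → ℕ`: `g(T) = Σ_{S ⊆ T} f(S)` (Williams 2014,
proof of Lemma 4.2). [cite: Williams2014, Lemma 4.2] -/
def zetaTransform (f : Finset (Fin n) → ℕ) (T : Finset (Fin n)) : ℕ :=
  ∑ S ∈ T.powerset, f S

/-- The zeta transform of the multiplicity function of a list of sets, at `T`, counts the members
of the list contained in `T`. [folklore] -/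
theorem countP_subset_eq_zetaTransform_count (l : List (Finset (Fin n))) (T : Finset (Fin n)) :
    l.countP (fun t => decide (t ⊆ T)) = zetaTransform (fun U => l.count U) T := by
  unfold zetaTransform
  induction l with
  | nil => simp
  | cons t l ih =>
    rw [List.countP_cons, ih]
    simp only [List.count_cons, beq_iff_eq, Finset.sum_add_distrib, Finset.sum_ite_eq,
      Finset.mem_powerset, decide_eq_true_eq]

/-- The zeta transform of the multiplicity function of a list never exceeds the length of the
list (so the table entries of Williams' algorithm have `O(log s)` bits). [folklore] -/
theorem zetaTransform_count_le (l : List (Finset (Fin n))) (T : Finset (Fin n)) :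
    zetaTransform (fun U => l.count U) T ≤ l.length := by
  rw [← countP_subset_eq_zetaTransform_count]
  exact List.countP_le_length

namespace SymPlus

/-- The set of coordinates set to `1` by the assignment `x` (Williams' "`T`"). [folklore] -/
def support (x : Fin n → Bool) : Finset (Fin n) := univ.filter fun i => x i = true

/-- A term is satisfied by `x` iff it is contained in the support of `x`. [folklore] -/
theorem forall_mem_iff_subset_support (t : Finset (Fin n)) (x : Fin n → Bool) :
    (∀ i ∈ t, x i = true) ↔ t ⊆ support x :=
  ⟨fun h _ hi => Finset.mem_filter.2 ⟨Finset.mem_univ _, h _ hi⟩,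
    fun h _ hi => (Finset.mem_filter.1 (h hi)).2⟩

/-- **The count of a `SYM⁺` circuit is the zeta transform of its term multiplicities**
(Williams 2014, proof of Lemma 4.2: "`g(T)` equals the number of AND gates set to `1` on the
variable assignment obtained by setting `xᵢ = 1` for `i ∈ T`, and `xᵢ = 0` for `i ∉ T`").
[cite: Williams2014, Lemma 4.2] -/
theorem count_eq_zetaTransform (S : SymPlus n) (x : Fin n → Bool) :
    S.count x = zetaTransform (fun U => S.terms.count U) (support x) := by
  rw [count, ← countP_subset_eq_zetaTransform_count]
  refine List.countP_congr fun t _ => ?_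
  simp only [decide_eq_true_eq]
  exact forall_mem_iff_subset_support t x

/-- The value of a `SYM⁺` circuit at `x` is the symmetric gate applied to the zeta transform of
the term multiplicities at the support of `x`. [cite: Williams2014, Lemma 4.2] -/
theorem eval_eq_sym_zetaTransform (S : SymPlus n) (x : Fin n → Bool) :
    S.eval x = S.sym (zetaTransform (fun U => S.terms.count U) (support x)) := by
  rw [eval, count_eq_zetaTransform]

/-- The support of the indicator assignment of `T` is `T`. [folklore] -/
theorem support_indicator (T : Finset (Fin n)) : support (fun i => decide (i ∈ T)) = T := by
  ext i
  simp [support]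

/-- **The final scan**: a `SYM⁺` circuit is satisfiable iff some entry of the zeta-transformed
multiplicity table is accepted by the symmetric gate (Williams 2014, proof of Lemma 4.2 /
Thm. 4.1: "hence if we can compute `g` then we can evaluate `C''` on all of its possible
inputs"). [cite: Williams2014, Lemma 4.2] -/
theorem exists_eval_iff (S : SymPlus n) :
    (∃ x, S.eval x = true) ↔ ∃ T : Finset (Fin n), S.sym (zetaTransform (fun U => S.terms.count U) T) = true := by
  constructor
  · rintro ⟨x, hx⟩
    exact ⟨support x, by rwa [eval_eq_sym_zetaTransform] at hx⟩
  · rintro ⟨T, hT⟩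
    refine ⟨fun i => decide (i ∈ T), ?_⟩
    rwa [eval_eq_sym_zetaTransform, support_indicator]

end SymPlus

/-! ### Yates' dynamic programme -/

/-- One stage of Yates' algorithm at the coordinate `i`:
`g'(T) = g(T) + g(T ∖ {i})` if `i ∈ T`, and `g'(T) = g(T)` otherwise (Williams 2014, proof of
Lemma 4.2). [cite: Williams2014, Lemma 4.2] -/
def yatesStep (i : Fin n) (g : Finset (Fin n) → ℕ) (T : Finset (Fin n)) : ℕ :=
  if i ∈ T then g T + g (T.erase i) else g T

/-- Yates' algorithm after `k` stages: `g₀ = f`, and stage `k < n` applies `yatesStep` at the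
coordinate `k` (stages `k ≥ n` do nothing) (Williams 2014, proof of Lemma 4.2).
[cite: Williams2014, Lemma 4.2] -/
def yatesIter (f : Finset (Fin n) → ℕ) : ℕ → Finset (Fin n) → ℕ
  | 0 => f
  | k + 1 => fun T => if h : k < n then yatesStep ⟨k, h⟩ (yatesIter f k) T else yatesIter f k T

/-- The invariant sums: `Σ f(S)` over the `S ⊆ T` that contain every element of `T` with
coordinate `≥ k` (i.e. agree with `T` from coordinate `k` on). [cite: Williams2014, Lemma 4.2] -/
def yatesPartial (f : Finset (Fin n) → ℕ) (k : ℕ) (T : Finset (Fin n)) : ℕ :=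
  ∑ S ∈ T.powerset.filter (fun S => ∀ j ∈ T, k ≤ (j : ℕ) → j ∈ S), f S

/-- At stage `0` the invariant sum is `f T` itself. [folklore] -/
theorem yatesPartial_zero (f : Finset (Fin n) → ℕ) (T : Finset (Fin n)) : yatesPartial f 0 T = f T := by
  unfold yatesPartial
  have : T.powerset.filter (fun S => ∀ j ∈ T, 0 ≤ (j : ℕ) → j ∈ S) = {T} := by
    ext S
    rw [mem_filter, mem_powerset, mem_singleton]
    constructor
    · rintro ⟨h1, h2⟩
      exact Subset.antisymm h1 fun j hj => h2 j hj (Nat.zero_le _)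
    · rintro rfl
      exact ⟨Subset.rfl, fun j hj _ => hj⟩
  rw [this, sum_singleton]

/-- Past the last coordinate the invariant sum is the zeta transform. [folklore] -/
theorem yatesPartial_of_le {f : Finset (Fin n) → ℕ} {k : ℕ} (hk : n ≤ k) (T : Finset (Fin n)) :
    yatesPartial f k T = zetaTransform f T := by
  unfold yatesPartial zetaTransform
  congr 1
  exact filter_true_of_mem fun S _ j _ hkj => absurd (hk.trans hkj) (not_le.2 j.2)

/-- Stage `k` at a set not containing the coordinate `k` changes nothing. [folklore] -/
theorem yatesPartial_succ_of_not_mem {f : Finset (Fin n) → ℕ} {k : ℕ} (hk : k < n)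
    {T : Finset (Fin n)} (hT : (⟨k, hk⟩ : Fin n) ∉ T) :
    yatesPartial f (k + 1) T = yatesPartial f k T := by
  unfold yatesPartial
  congr 1
  refine filter_congr fun S _ => forall₂_congr fun j hj => ?_
  have hjk : (j : ℕ) ≠ k := fun h =>
    hT (by rwa [show (⟨k, hk⟩ : Fin n) = j from Fin.ext h.symm])
  constructor
  · intro h hkj
    exact h (by omega)
  · intro h hkj
    exact h (by omega)

/-- Stage `k` at a set containing the coordinate `k`: the new sum splits according to whether
`S` contains `k` (Williams 2014, proof of Lemma 4.2, the induction step). [cite: Williams2014, Lemma 4.2] -/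
theorem yatesPartial_succ_of_mem {f : Finset (Fin n) → ℕ} {k : ℕ} (hk : k < n)
    {T : Finset (Fin n)} (hT : (⟨k, hk⟩ : Fin n) ∈ T) :
    yatesPartial f (k + 1) T = yatesPartial f k T + yatesPartial f k (T.erase ⟨k, hk⟩) := by
  set i : Fin n := ⟨k, hk⟩ with hi
  have hval : ∀ j : Fin n, k ≤ (j : ℕ) → j ≠ i → k + 1 ≤ (j : ℕ) := by
    intro j hkj hji
    have : (j : ℕ) ≠ k := fun h => hji (Fin.ext h)
    omega
  unfold yatesPartial
  rw [← sum_filter_add_sum_filter_not (T.powerset.filter _) (fun S => i ∈ S), filter_filter,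
    filter_filter]
  congr 1
  · refine Finset.sum_congr (filter_congr fun S _ => ?_) fun _ _ => rfl
    constructor
    · rintro ⟨h, hiS⟩ j hj hkj
      by_cases hji : j = i
      · rw [hji]
        exact hiS
      · exact h j hj (hval j hkj hji)
    · intro h
      exact ⟨fun j hj hkj => h j hj (by omega), h i hT le_rfl⟩
  · refine Finset.sum_congr ?_ fun _ _ => rfl
    ext S
    simp only [mem_filter, mem_powerset, subset_erase, mem_erase]
    constructor
    · rintro ⟨hST, h, hiS⟩
      exact ⟨⟨hST, hiS⟩, fun j hj hkj => h j hj.2 (hval j hkj hj.1)⟩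
    · rintro ⟨⟨hST, hiS⟩, h⟩
      refine ⟨hST, fun j hj hkj => h j ⟨?_, hj⟩ (by omega), hiS⟩
      rintro rfl
      rw [hi] at hkj
      exact absurd hkj (by simp)

/-- **Correctness of Yates' algorithm, stage by stage**: for `k ≤ n`, after `k` stages the table
holds the invariant sums `yatesPartial f k` (Williams 2014, proof of Lemma 4.2: "Induction shows
that `gᵢ(T) = Σ f(S)` where the sum is over all `S ⊆ T` subject to the condition
`{j ∈ S | j > i} = {j ∈ T | j > i}`"). [cite: Williams2014, Lemma 4.2] -/
theorem yatesIter_eq_partial (f : Finset (Fin n) → ℕ) :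
    ∀ k, k ≤ n → ∀ T, yatesIter f k T = yatesPartial f k T
  | 0, _, T => (yatesPartial_zero f T).symm
  | k + 1, hk, T => by
    have hkn : k < n := hk
    simp only [yatesIter, dif_pos hkn, yatesStep]
    split_ifs with hT
    · rw [yatesIter_eq_partial f k hkn.le T, yatesIter_eq_partial f k hkn.le (T.erase _),
        yatesPartial_succ_of_mem hkn hT]
    · rw [yatesIter_eq_partial f k hkn.le T, yatesPartial_succ_of_not_mem hkn hT]

/-- **Yates' algorithm computes the zeta transform**: after the `n` stages, `g_n = g`
(Williams 2014, proof of Lemma 4.2: "When `i = n`, both of these sets are always empty, so it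
follows that `g_n = g`"). [cite: Williams2014, Lemma 4.2] -/
theorem yatesIter_n (f : Finset (Fin n) → ℕ) (T : Finset (Fin n)) :
    yatesIter f n T = zetaTransform f T := by
  rw [yatesIter_eq_partial f n le_rfl T, yatesPartial_of_le le_rfl]

/-- Consequently Yates' algorithm applied to the term multiplicities of a `SYM⁺` circuit yields,
at the support of `x`, the number of terms true at `x` — the table from which the circuit is read
off on all `2ⁿ` inputs (Williams 2014, Lemma 4.2). [cite: Williams2014, Lemma 4.2] -/
theorem SymPlus.count_eq_yatesIter (S : SymPlus n) (x : Fin n → Bool) :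
    S.count x = yatesIter (fun U => S.terms.count U) n (SymPlus.support x) := by
  rw [yatesIter_n, SymPlus.count_eq_zetaTransform]

end Literature.Computability.Complexity
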